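import Summits.ABC.ABC.Theses.DefiniteXi
import Summits.ABC.ABC.Theorems.DefiniteXiDefiniteRTControlPrimeTwoFacts
import Summits.ABC.ABC.Theorems.DefiniteXiMinimalBoundGivesTarget
import Summits.ABC.ABC.Theorems.DefiniteXiDegreeBoundToABCOfPetersson
import Summits.ABC.ABC.Theorems.RibetTakahashiSplitWeightedSzpiroBoundForgivenDegreeBoundOfDefiniteXi
import HarnessLib

/-!
# `stub_takahashi` (crux stmt-ABC-11338 `DefiniteXi.DefiniteRTControlPrime`) — ideator k1, gen 20,
# FAMILY 1 companion: the IMPORT executed at the level where it has teeth (route items), typed.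

The stub `theorem stub_takahashi : takahashi2001_thm_2_3_of_coprime` is VERBATIM a cite-tagged
named Literature fact (Takahashi 2001 Thm 2.3 at `r ∥ N`).  No hypothesis-free proof exists or is in
reach (Néron models / character groups of `J₀(N)` absent).  The FAMILY-1 move "import as a named
fact, consumers take `(h : X)`" therefore cannot be made INSIDE the skeleton (a stub must be closed
outright) — but it can be made one level up, exactly as this route already did for Pasten's two
facts (`MazurKenkuBound` = stmt-ABC-15125, `IsogenyValuationTransport` = stmt-ABC-18928, route-choice
promotions 1e5e4a86 / d59cfa0c, bodies verbatim, `Iff.rfl`):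

* (I)  promote the fact to a rank-9 route item `TakahashiDegreeFormulaCoprime` (body verbatim);
* (G)  `DefiniteRTControlPrime` then follows from the two ITEMS by the LANDED
       `definiteRTControlPrime_of_two_facts` (p838145) — no Lemma 6.8, no third fact;
* (C)  the deciding theorem re-glues with `(hT) (hMK)` in place of `(hRT)`; open load-bearing
       binders become {EisensteinQuarantine, SteinbergCore, TakahashiDegreeFormulaCoprime,
       MazurKenkuBound, FreyModularity, PeterssonLowerBound} = 6 (BC1 pass), and drop to 5 when the
       k2-g12 Takahashi-only certificate (`definiteRTControlPrime_of_takahashi`, landing as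
       `…CyclicCharacter*.lean`, p839012/p839017/p839057 accepted) replaces (G).

Everything below elaborates against the tree as of 2026-09-01T01:10Z (no `sorry`).
-/

set_option linter.dupNamespace false

namespace Summit.ABC.ABC.Cruxes.DefiniteRTControlPrime.StubIdeas1G20

open Summit.ABC.ABC.Theses.DefiniteXi
open Literature.NumberTheory.EllipticCurves Literature.NumberTheory.EllipticCurves.ModularForms
open Literature.NumberTheory.Automorphic

/-- (I) Proposed route item (kind `support`, rank 9, "KNOWN in print, XL formal debt"), body VERBATIM
the Literature fact `takahashi2001_thm_2_3_of_coprime` (Takahashi 2001 Thm 2.3 at `r ∥ N`, `D = 1`):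
for `W/ℚ` of conductor `M r`, `r` prime, `gcd(M,r)=1`, `P` a datum of minimal degree among all data at
level `M r` of conductor-`M r` curves with the same newform, and every Brandt setup `S` of type `(M,r)`:
`∃ i j, 0 < i ∧ i j = ord_r Δ_min(W) ∧ i ∣ ξ_S(a(W)) ∧ deg P · i = ξ_S(a(W)) · j`. -/
def TakahashiDegreeFormulaCoprime : Prop :=
  ∀ (W : WeierstrassCurve ℚ) [W.IsElliptic] (M r : ℕ) [NeZero (M * r)],
    r.Prime → M.Coprime r → W.conductorNorm ℤ = M * r →
    ∀ P : ModularParametrizationData W (M * r),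
      (∀ (W' : WeierstrassCurve ℚ) [W'.IsElliptic], W'.conductorNorm ℤ = M * r →
          ∀ P' : ModularParametrizationData W' (M * r),
          P'.f = P.f → P.modularDegree ≤ P'.modularDegree) →
      ∀ S : Brandt.XiSetup M r,
        ∃ i j : ℕ, 0 < i ∧ i * j = (W.minimalDiscriminantNorm ℤ).factorization r ∧
          i ∣ S.xi (fun n => W.LFunction n) ∧
          P.modularDegree * i = S.xi (fun n => W.LFunction n) * j

/-- The promotion is definitional (same certificate shape as `mazurKenkuBound_iff`,
`isogenyValuationTransport_iff` in `DefiniteXiXiStrongBoundItemsCalibration.lean`). -/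
theorem takahashiDegreeFormulaCoprime_iff :
    TakahashiDegreeFormulaCoprime ↔ takahashi2001_thm_2_3_of_coprime :=
  Iff.rfl

/-- (D) Plan A door, typed: the registered stub's statement IS the item / the fact — a stub prover can
only write `exact h` given `h`, i.e. end `blocked-on: takahashi2001_thm_2_3_of_coprime`. -/
theorem stub_takahashi_of_item (h : TakahashiDegreeFormulaCoprime) :
    takahashi2001_thm_2_3_of_coprime :=
  h

/-- (G) The crux from the two ROUTE ITEMS (Takahashi promoted + `MazurKenkuBound`), by the landed
two-fact closer `definiteRTControlPrime_of_two_facts` (p838145; `C = 4·163³`, `N^ε` idle). -/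
theorem definiteRTControlPrime_of_route_items (hT : TakahashiDegreeFormulaCoprime)
    (hMK : MazurKenkuBound) : DefiniteRTControlPrime :=
  Summit.ABC.ABC.Theorems.DefiniteRTControlPrime.definiteRTControlPrime_of_two_facts hT hMK

/-- (C) The re-glued deciding theorem — what `glue.lean`'s `closes` becomes after the promotion:
binders are route items only, conclusion `ABC`; `hRT` is no longer a binder. -/
theorem closes_of_takahashiItem (hEis : EisensteinQuarantine) (hCore : SteinbergCore)
    (hT : TakahashiDegreeFormulaCoprime) (hMK : MazurKenkuBound)
    (hGlue : DefiniteGlue) (hMod : FreyModularity) (hMin : MinimalBoundGivesTarget)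
    (hP : PeterssonLowerBound) (hDeg : DegreeBoundToABCOfPetersson) : _root_.ABC :=
  closes hEis hCore (definiteRTControlPrime_of_route_items hT hMK) hGlue hMod hMin hP hDeg

/-- (C′) Same with the three PROVED supports discharged by name (`definiteGlue_holds`,
`minimalBoundGivesTarget_proof`, `degreeBoundToABCOfPetersson_proof`): the OPEN load-bearing binders
of the re-glued route are exactly these six. -/
theorem closes_of_takahashiItem' (hEis : EisensteinQuarantine) (hCore : SteinbergCore)
    (hT : TakahashiDegreeFormulaCoprime) (hMK : MazurKenkuBound) (hMod : FreyModularity)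
    (hP : PeterssonLowerBound) : _root_.ABC :=
  closes_of_takahashiItem hEis hCore hT hMK
    Summit.ABC.ABC.Theorems.TwoAdicEisensteinAnchor.definiteGlue_holds hMod
    Summit.ABC.ABC.Theorems.minimalBoundGivesTarget_proof hP
    Summit.ABC.ABC.Theorems.degreeBoundToABCOfPetersson_proof

end Summit.ABC.ABC.Cruxes.DefiniteRTControlPrime.StubIdeas1G20
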